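import Mathlib
import Summits.CriticalPhenomena.PercolationContinuityZ3.Theorems.PinholeClosing.Negative.PinholeClosingBaseline
import Literature.Probability.Percolation.BlockConditioning
import Literature.Probability.Percolation.FiniteEnergy
import Literature.Probability.Percolation.BernoulliPercolation
import Literature.Probability.Percolation.RevealmentOrthogonality
import Literature.Probability.LatticeModels.LatticeGraph
import HarnessLib

/-!
# Crux `PercBudgetLadder.PinholeClosing` (stmt-CriticalPhenomena-5249), line `balanced-deletion` — stub `stub_switching`

Helper file for the crux skeleton `Cruxes/PinholeClosing/Lines/balanced_deletion.lean`
(lead prover-line-stmt-CriticalPhenomena-5249-c1-0); proves exactly the registered stub `stub_switching` of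
that skeleton (`--supports stmt-CriticalPhenomena-5249`), one namespace down as
`Summit.CriticalPhenomena.PercolationContinuityZ3.Theorems.BalancedDeletion.stub_switching`.  No new
definitions: the statement is in the tree's vocabulary (`bondPercolation (zdGraph 3) (criticalProbI 3)`,
`BondConfig`, `Set.indicator`).

Informal statement (the single-edge SWITCHING IDENTITY).  Write `P = bondPercolation (zdGraph 3) (criticalProbI 3)`
and `p_c = criticalProbI 3`.  For a lattice edge `f ∈ E(ℤ³)` and a bounded measurable
`φ : BondConfig (Site 3) → ℝ`:  `p_c · E[φ ; f closed] = (1 - p_c) · E[φ(ω ∖ f) ; f open]`.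

Proof route.  Both sides equal `p_c (1 - p_c) · E[φ(ω ∖ f)]`.  Pointwise,
`(𝟙{f closed} φ)(ω) = 𝟙{f closed}(ω) · φ(ω ∖ f)` (as `ω ∖ f = ω` when `f` is closed) and
`(𝟙{f open} φ(· ∖ f))(ω) = 𝟙{f open}(ω) · φ(ω ∖ f)`.  The factor `𝟙{f open}` (resp. `𝟙{f closed}`) is
measurable for the σ-algebra `σ({f})` of the single edge (`edgeSigma`, `measurable_indicator_one_edgeSigma` of
`FiniteEnergy.lean` / `RevealmentOrthogonality.lean`), while `ω ↦ φ(ω ∖ f)` is `σ({f}ᶜ)`-measurable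
(`measurable_inter_edgeSigma`), so the expectation of the product factorises
(`integral_mul_eq_of_edgeSigma`: disjoint edge sets are independent under the product measure `P_p`,
Grimmett, *Percolation* (1999), §2.2), with `P(f open) = p_c` (`bondPercolation_cylinder`) and
`P(f closed) = 1 - p_c` (complement).  The boundedness hypothesis of the stub is not needed.
-/

noncomputable section

namespace Summit.CriticalPhenomena.PercolationContinuityZ3.Theorems

open MeasureTheory
open Literature.Probability.Percolation Literature.Probability.LatticeModels
open Summit.CriticalPhenomena.PercolationContinuityZ3.Theorems.PinholeClosing.Negative

namespace BalancedDeletion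

namespace Switching

variable {V : Type*}

/-- `(𝟙{f closed} φ)(ω) = 𝟙{f closed}(ω) · φ(ω ∖ f)`: when `f` is closed, `ω ∖ {f} = ω`. [folklore] -/
theorem indicator_notMem_eq_mul (f : Sym2 V) (φ : BondConfig V → ℝ) (ω : BondConfig V) :
    {ω : BondConfig V | f ∉ ω}.indicator φ ω =
      {ω : BondConfig V | f ∉ ω}.indicator (1 : BondConfig V → ℝ) ω * φ (ω \ {f}) := by
  by_cases h : f ∈ ω
  · have h' : ω ∉ {ω : BondConfig V | f ∉ ω} := fun h'' => h'' h
    rw [Set.indicator_of_notMem h', Set.indicator_of_notMem h', zero_mul]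
  · have h' : ω ∈ {ω : BondConfig V | f ∉ ω} := h
    rw [Set.indicator_of_mem h', Set.indicator_of_mem h', Pi.one_apply, one_mul,
      Set.sdiff_singleton_eq_self h]

/-- `(𝟙{f open} φ(· ∖ f))(ω) = 𝟙{f open}(ω) · φ(ω ∖ f)`. [folklore] -/
theorem indicator_mem_eq_mul (f : Sym2 V) (φ : BondConfig V → ℝ) (ω : BondConfig V) :
    {ω : BondConfig V | f ∈ ω}.indicator (fun ω => φ (ω \ {f})) ω =
      {ω : BondConfig V | f ∈ ω}.indicator (1 : BondConfig V → ℝ) ω * φ (ω \ {f}) := by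
  by_cases h : f ∈ ω
  · have h' : ω ∈ {ω : BondConfig V | f ∈ ω} := h
    rw [Set.indicator_of_mem h', Set.indicator_of_mem h', Pi.one_apply, one_mul]
  · have h' : ω ∉ {ω : BondConfig V | f ∈ ω} := h
    rw [Set.indicator_of_notMem h', Set.indicator_of_notMem h', zero_mul]

/-- The state of the edge `f` is determined by the single edge `f`. [folklore] -/
theorem determinedBy_setOf_mem (f : Sym2 V) :
    DeterminedBy {ω : BondConfig V | f ∈ ω} ({f} : Set (Sym2 V)) := by
  rw [determinedBy_iff]
  intro ω ω' h
  have key := Set.ext_iff.1 h f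
  simp only [Set.mem_inter_iff, Set.mem_singleton_iff, and_true] at key
  exact key

/-- The event "`f` is closed" is determined by the single edge `f`. [folklore] -/
theorem determinedBy_setOf_notMem (f : Sym2 V) :
    DeterminedBy {ω : BondConfig V | f ∉ ω} ({f} : Set (Sym2 V)) := by
  rw [determinedBy_iff]
  intro ω ω' h
  have key := Set.ext_iff.1 h f
  simp only [Set.mem_inter_iff, Set.mem_singleton_iff, and_true] at key
  exact not_congr key

/-- `ω ↦ φ(ω ∖ f)` is measurable for the σ-algebra generated by the edges other than `f`
(it factors through the restriction `ω ↦ ω ∩ {f}ᶜ = ω ∖ {f}`). [folklore] -/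
theorem measurable_comp_sdiff_edgeSigma (f : Sym2 V) {φ : BondConfig V → ℝ} (hφ : Measurable φ) :
    Measurable[edgeSigma ({f} : Set (Sym2 V))ᶜ] fun ω : BondConfig V => φ (ω \ {f}) :=
  hφ.comp (measurable_inter_edgeSigma ({f} : Set (Sym2 V))ᶜ)

/-- `P_p(f closed) = 1 - p` for an edge `f` of `G` (Grimmett, *Percolation* (1999), §1.3). [folklore] -/
theorem real_setOf_notMem (G : SimpleGraph V) (p : unitInterval) {f : Sym2 V} (hf : f ∈ G.edgeSet) :
    (bondPercolation G p).real {ω : BondConfig V | f ∉ ω} = 1 - (p : ℝ) := by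
  have h : {ω : BondConfig V | f ∉ ω} = {ω | f ∈ ω}ᶜ := rfl
  rw [h, measureReal_compl (measurableSet_mem f), probReal_univ, bondPercolation_cylinder G p hf]

variable [Countable V] (G : SimpleGraph V) (p : unitInterval)

/-- **Factorisation off one edge.**  For a measurable event `A` determined by the single edge `f` and a
measurable `φ`, `∫ 𝟙_A(ω) φ(ω ∖ f) dP_p = P_p(A) · ∫ φ(ω ∖ f) dP_p`: the σ-algebras `σ({f})` and `σ({f}ᶜ)`
are independent under the product measure (Grimmett, *Percolation* (1999), §2.2; tree lemma
`integral_mul_eq_of_edgeSigma`). [folklore] -/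
theorem integral_indicator_mul_comp_sdiff (f : Sym2 V) {A : Set (BondConfig V)}
    (hA : DeterminedBy A ({f} : Set (Sym2 V))) (hAm : MeasurableSet A)
    {φ : BondConfig V → ℝ} (hφ : Measurable φ) :
    ∫ ω, A.indicator (1 : BondConfig V → ℝ) ω * φ (ω \ {f}) ∂(bondPercolation G p) =
      (bondPercolation G p).real A * ∫ ω, φ (ω \ {f}) ∂(bondPercolation G p) := by
  rw [integral_mul_eq_of_edgeSigma G p _root_.disjoint_compl_right
      (measurable_indicator_one_edgeSigma hA hAm) (measurable_comp_sdiff_edgeSigma f hφ),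
    integral_indicator_one hAm]

/-- **Switching identity, closed side**: `E_p[φ ; f closed] = (1 - p) · E_p[φ(ω ∖ f)]` for an edge `f` of
`G` and a measurable `φ`. [folklore] -/
theorem integral_indicator_notMem {f : Sym2 V} (hf : f ∈ G.edgeSet) {φ : BondConfig V → ℝ}
    (hφ : Measurable φ) :
    ∫ ω, {ω : BondConfig V | f ∉ ω}.indicator φ ω ∂(bondPercolation G p) =
      (1 - (p : ℝ)) * ∫ ω, φ (ω \ {f}) ∂(bondPercolation G p) := by
  have h : ∫ ω, {ω : BondConfig V | f ∉ ω}.indicator φ ω ∂(bondPercolation G p) =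
      ∫ ω, {ω : BondConfig V | f ∉ ω}.indicator (1 : BondConfig V → ℝ) ω * φ (ω \ {f})
        ∂(bondPercolation G p) :=
    integral_congr_ae (ae_of_all _ fun ω => indicator_notMem_eq_mul f φ ω)
  rw [h, integral_indicator_mul_comp_sdiff G p f (determinedBy_setOf_notMem f) (measurableSet_notMem f) hφ,
    real_setOf_notMem G p hf]

/-- **Switching identity, open side**: `E_p[φ(ω ∖ f) ; f open] = p · E_p[φ(ω ∖ f)]` for an edge `f` of `G`
and a measurable `φ`. [folklore] -/
theorem integral_indicator_mem {f : Sym2 V} (hf : f ∈ G.edgeSet) {φ : BondConfig V → ℝ}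
    (hφ : Measurable φ) :
    ∫ ω, {ω : BondConfig V | f ∈ ω}.indicator (fun ω => φ (ω \ {f})) ω ∂(bondPercolation G p) =
      (p : ℝ) * ∫ ω, φ (ω \ {f}) ∂(bondPercolation G p) := by
  have h : ∫ ω, {ω : BondConfig V | f ∈ ω}.indicator (fun ω => φ (ω \ {f})) ω ∂(bondPercolation G p) =
      ∫ ω, {ω : BondConfig V | f ∈ ω}.indicator (1 : BondConfig V → ℝ) ω * φ (ω \ {f})
        ∂(bondPercolation G p) :=
    integral_congr_ae (ae_of_all _ fun ω => indicator_mem_eq_mul f φ ω)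
  rw [h, integral_indicator_mul_comp_sdiff G p f (determinedBy_setOf_mem f) (measurableSet_mem f) hφ,
    bondPercolation_cylinder G p hf]

end Switching

/-- **Single-edge switching identity for critical bond percolation on `ℤ³`** (line `balanced-deletion`,
registered stub `stub_switching`, VERBATIM signature).  For a lattice edge `f` and a bounded measurable `φ`,
`p_c · ∫ 𝟙{f ∉ ω} φ(ω) dP = (1 - p_c) · ∫ 𝟙{f ∈ ω} φ(ω ∖ {f}) dP`, `P = bondPercolation (zdGraph 3) (criticalProbI 3)`:
both sides are `p_c (1 - p_c) ∫ φ(ω ∖ {f}) dP` by `Switching.integral_indicator_notMem` /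
`Switching.integral_indicator_mem` (independence of the state of `f` from `ω ∖ {f}`). -/
theorem stub_switching :
    ∀ (f : Sym2 (Site 3)) (φ : BondConfig (Site 3) → ℝ) (C : ℝ), f ∈ (zdGraph 3).edgeSet → Measurable φ →
      (∀ ω, |φ ω| ≤ C) →
      ((criticalProbI 3 : unitInterval) : ℝ) *
          ∫ ω, {ω : BondConfig (Site 3) | f ∉ ω}.indicator φ ω ∂(bondPercolation (zdGraph 3) (criticalProbI 3)) =
        (1 - ((criticalProbI 3 : unitInterval) : ℝ)) *
          ∫ ω, {ω : BondConfig (Site 3) | f ∈ ω}.indicator (fun ω => φ (ω \ {f})) ω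
            ∂(bondPercolation (zdGraph 3) (criticalProbI 3)) := by
  intro f φ _ hf hφ _
  rw [Switching.integral_indicator_notMem (zdGraph 3) (criticalProbI 3) hf hφ,
    Switching.integral_indicator_mem (zdGraph 3) (criticalProbI 3) hf hφ]
  ring

end BalancedDeletion

end Summit.CriticalPhenomena.PercolationContinuityZ3.Theorems

end
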